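import Summits.PneNP.PneNP.Theorems.ChebyshevTracialDesignTiltedJuntaAverage
import Summits.PneNP.PneNP.Theorems.ChebyshevTracialDesignTiltedSmallBlockAllDirections
import Summits.PneNP.PneNP.Theorems.ChebyshevTracialDesignTiltedSmallBlockAmplitudeOneCutoff
import HarnessLib

/-!
# Cell pnp-psdrank, route `ChebyshevTracialDesign`: (CG_1′) AND THE 𝒜₁ RUNG FOR EVERY JUNTA MASK ON BLOCKS WITH `100|H|(|H|+1) ≤ n·dq n`
# (`|H| ≲ n^{5/8}/10`), ALL DIRECTIONS, EVERY DIMENSION (brick J6 = 163e; crux `TracialDecayExp20`, stmt-PneNP-19878)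

Brick 163e (prover g31; MEMO-34 §7; the junta form of brick 156). Brick 163d reaches junta masks on `4|H| ≤ ⌊√n⌋` coordinates with no cut-off on
the number of internal matching edges. With brick 163c's CUT-OFF headline `tilted_designValue_avg_le_cutoff_pow_J` at `a₁ = ⌊dq n/4⌋` (the matchings
with more than `⌊dq n/2⌋−1` edges inside `H` are charged to the `a`-tail climbed only from `a₁`, eng's T-K4b mechanism) and brick 156's arithmetic
`sqrtD_block_admissible`, the same statements hold for every block with `100|H|(|H|+1) ≤ n·dq n`, at the price of the decay `(1/9)^{⌊dq n/2⌋−⌊dq n/4⌋}`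
on the tail term. For some `a > 0` and all large even `n`, every balanced `B = 20` Chebyshev design `(t,C,w)`, every such `H` and every junta mask
`0 ≤ f ≤ G` of the in-set:
* **`mediumJunta_amplitudeOne_value_le`** — every degree-one Gram contraction `B_U = Σ_p x_p(U)β_p` (`B_UB_Uᵀ ⪯ I` on the `t`-cuts), every psd
  contraction field `0 ⪯ Y_M ⪯ I` of dimension `r`:
  `Σ_{U,M} W·f(U∩H)·tr(B_UB_UᵀY_M) ≤ 8·(20G((4|H|+t+5Tq n+4)²(1/3)^{⌊dq n/2⌋−1} + (|H|+1)n²(1/9)^{⌊dq n/2⌋−⌊dq n/4⌋}) + 160Gn⁶e^{−a·dq n} + 60Gn⁴√P_{dq n−4})·r`;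
* `mediumJunta_allDirections_pairSymm_le`, **`mediumJunta_containment_allDirections_decay`** — for EVERY direction field `v : PM_n → [n] → [−1,1]`:
  `Σ_M (Σ_U W(U,M)·f(U∩H)·(Σ_p v_M(p)x_px_{π_Mp})²)₊ ≤ 20G((4|H|+t+5Tq n+4)²(1/3)^{⌊dq n/2⌋−1} + (|H|+1)n²(1/9)^{⌊dq n/2⌋−⌊dq n/4⌋}) + 160Gn⁶e^{−a·dq n}`.
READING: the junta cells of (CG_1′)/𝒜₁ are priced for supports of size `≲ n^{5/8}/10` (this file), extending 163d (`≤ √n/4`) and 113–116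
(`≲ dq n·ln n`); the open heart of the crux is unchanged: spread / non-junta masks (N2).
[cite: Rothvoss2017, §2 and Lemma 7 (PDF pp. 5–8)] [cite: GriblingDelaatLaurent2019, §5] [cite: KeevashLifshitz2023, Thm. 1.8]
Stature: support/instrument (kernel lane, no defs, axioms standard); asymptotic in `a` (the `r = 1` rung). WHAT THIS IS NOT: nothing on non-junta masks,
no proof or refutation of `TracialDecayExp20`, nothing on psd rank of P_PM(K_n), no P-vs-NP content. Supports stmt-PneNP-19878.
-/

set_option linter.dupNamespace false -- `Summit.PneNP.PneNP.…`: summit = sub-problem (D-0017)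

noncomputable section

namespace Summit.PneNP.PneNP.Theorems.ChebyshevTracialDesignTiltedJuntaRungsCutoff

open Finset Matrix Literature.Barriers.PneNP Literature.Combinatorics.Optimization
open Summit.PneNP.PneNP.Theorems.ChebyshevTracialDesignColourSymmetricAmplitudeOne (colourSymmetric_amplitudeOne_of_typeConstant)
open Summit.PneNP.PneNP.Theorems.ChebyshevTracialDesignColourSymmetricReduction (colourSymmetric_allDirections_reduction)
open Summit.PneNP.PneNP.Theorems.ChebyshevTracialDesignUnconditionalRungs (rectangleDecayExp_all_holds)
open Summit.PneNP.PneNP.Theorems.ChebyshevTracialDesignAllDirections (abs_classAvg_le_one)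
open Summit.PneNP.PneNP.Theorems.ChebyshevTracialDesignHSymmetricAmplitudeOne (containment_pairSymm)
open Summit.PneNP.PneNP.Theorems.ChebyshevTracialDesignTiltedSmallBlockAmplitudeOne (dq_facts)
open Summit.PneNP.PneNP.Theorems.ChebyshevTracialDesignTiltedJuntaAverage (tilted_designValue_avg_le_cutoff_pow_J)
open Summit.PneNP.PneNP.Theorems.ChebyshevTracialDesignTiltedSmallBlockAmplitudeOneCutoff (sqrtD_block_admissible)
open Summit.PneNP.PneNP.Theorems.ChebyshevTracialDesignTiltedJuntaClassSplit (identityColour_facts)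

variable {n : ℕ}

/-! ### §1 The 𝒜₁ rung for junta masks on blocks with `100|H|(|H|+1) ≤ n·dq n` -/

/-- **THE 𝒜₁ RUNG FOR JUNTA MASKS ON BLOCKS OF SIZE `≲ √(n·dq n)/10` (brick 163e).** There are `a > 0` and `n₀` such that for all even
`n ≥ n₀`, every balanced `B = 20` Chebyshev design `(t, C, w)`, every block `H` with `100|H|(|H|+1) ≤ n·dq n`, every junta mask `0 ≤ f ≤ G`
of the in-set, every degree-one Gram contraction `B_U = Σ_p x_p(U)β_p` with `B_UB_Uᵀ ⪯ I` on the `t`-cuts and every psd contraction field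
`0 ⪯ Y_M ⪯ I` of dimension `r`:
`Σ_{U,M} W(U,M)·f(U∩H)·tr(B_UB_UᵀY_M) ≤ 8·(20G((4|H|+t+5Tq n+4)²(1/3)^{⌊dq n/2⌋−1} + (|H|+1)n²(1/9)^{⌊dq n/2⌋−⌊dq n/4⌋}) + 160Gn⁶e^{−a·dq n} + 60Gn⁴√P_{dq n−4})·r`
(brick 150b with the identity colouring of `H` (163a `identityColour_facts`), `Btc` := 163c `tilted_designValue_avg_le_cutoff_pow_J` at
`a₁ = ⌊dq n/4⌋`, admissibility = brick 156 `sqrtD_block_admissible`). [cite: Rothvoss2017, §2 (PDF pp. 5–6)] [cite: GriblingDelaatLaurent2019, §5] -/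
theorem mediumJunta_amplitudeOne_value_le :
    ∃ a : ℝ, 0 < a ∧ ∃ n₀ : ℕ, ∀ n : ℕ, n₀ ≤ n → Even n → ∀ {t : ℕ} {C : Finset ℕ} {w : ℕ → ℝ},
    IsBalancedDesign n t (Tq n) (dq n) 20 C w →
    ∀ (H : Finset (Fin n)), 100 * (H.card * (H.card + 1)) ≤ n * dq n →
    ∀ (f : Finset (Fin n) → ℝ) {G : ℝ}, (∀ I, |f I| ≤ G) → (∀ I, 0 ≤ f I) →
    ∀ {r m : ℕ} (β : Fin n → Matrix (Fin r) (Fin m) ℝ),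
    (∀ U : OddSet n, U.1.card = t →
      (1 - (∑ p, (if p ∈ U.1 then (1 : ℝ) else 0) • β p) * (∑ p, (if p ∈ U.1 then (1 : ℝ) else 0) • β p)ᵀ).PosSemidef) →
    ∀ (Y : PMatch n → Matrix (Fin r) (Fin r) ℝ), (∀ M, (Y M).PosSemidef ∧ (1 - Y M).PosSemidef) →
    ∑ U : OddSet n, ∑ M : PMatch n, levelWeight n t C w U M *
        (f (U.1 ∩ H) *
          ((∑ p, (if p ∈ U.1 then (1 : ℝ) else 0) • β p) * (∑ p, (if p ∈ U.1 then (1 : ℝ) else 0) • β p)ᵀ * Y M).trace) ≤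
      8 * (20 * G * ((4 * (H.card : ℝ) + t + 5 * (Tq n) + 4) ^ 2 * (1 / 3 : ℝ) ^ (dq n / 2 - 1) +
          ((H.card : ℝ) + 1) * (n : ℝ) ^ 2 * (1 / 9 : ℝ) ^ (dq n / 2 - dq n / 4)) +
        160 * G * (n : ℝ) ^ 6 * Real.exp (-(a * dq n)) +
        60 * G * (n : ℝ) ^ 4 * Real.sqrt (∏ i ∈ range ((dq n - 4) / 2 + 1), ((2 * i + 1 : ℝ) / ((n : ℝ) - 2 * i)))) * r := by
  classical
  obtain ⟨a, ha, n₀, h150⟩ := colourSymmetric_amplitudeOne_of_typeConstant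
  refine ⟨a, ha, max n₀ (12100 * 12100), ?_⟩
  intro n hn heven t C w hbal H hh f G hG hf0 r m β hβ Y hY
  have hn₀ : n₀ ≤ n := le_trans (le_max_left _ _) hn
  have hm : 12100 ≤ Nat.sqrt n := by rw [Nat.le_sqrt]; exact le_trans (le_max_right _ _) hn
  have h256 : 256 ≤ n := le_trans (by norm_num) (le_trans (le_max_right _ _) hn)
  obtain ⟨hD4, hDT⟩ := dq_facts h256
  have hdes : IsExactDesign n t (Tq n) (dq n) 20 C w := hbal.1
  have hG0 : 0 ≤ G := (abs_nonneg _).trans (hG ∅)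
  have hN : (univ : Finset (Fin n)).card = 2 * (n / 2) := by
    rw [card_univ, Fintype.card_fin]; obtain ⟨k, hk⟩ := heven; omega
  have hn4 : n ≤ 4 * t := hbal.2
  have h2t : 2 * t + 2 ≤ n := hbal.1.2.1
  obtain ⟨s₀, hs₀⟩ := hbal.1.1
  obtain ⟨h9, h2h, ha₁, hR1, hRa, hRb, hq, hθ⟩ := sqrtD_block_admissible (n := n) (h := H.card) hs₀ hn4 h2t hh hm
  -- the colouring and the mask
  obtain ⟨col, hc0, hcfix, htc⟩ := identityColour_facts H
  set fU : Finset (Fin n) → ℝ := fun U => f (U ∩ H) with hf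
  have hf0' : ∀ U, 0 ≤ fU U := fun U => hf0 _
  have hfG : ∀ U, fU U ≤ G := fun U => (le_abs_self _).trans (hG _)
  have hfinv : ∀ (M : PMatch n) (g : Equiv.Perm (Fin n)), (∀ i, g (M.2.partner i) = M.2.partner (g i)) →
      (∀ i, col (g i) = col i) → ∀ U : Finset (Fin n), fU (U.map g.toEmbedding) = fU U := by
    intro M g _ hg U
    rw [hf]
    simp only
    rw [hcfix g hg U]
  -- the colour-type-constant bound from brick 163c (cut-off headline)
  have hBtc : ∀ v : PMatch n → Fin n → ℝ, (∀ M p, |v M p| ≤ 1) →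
      (∀ M p p', s(col p, col (M.2.partner p)) = s(col p', col (M.2.partner p')) → v M p = v M p') →
      ∑ M : PMatch n, ∑ U : OddSet n, levelWeight n t C w U M * (fU U.1 *
        (∑ p : Fin n, v M p * ((if p ∈ U.1 then (1 : ℝ) else 0) * (if M.2.partner p ∈ U.1 then (1 : ℝ) else 0))) ^ 2) ≤
      20 * G * ((4 * (H.card : ℝ) + t + 5 * (Tq n) + 4) ^ 2 * (1 / 3 : ℝ) ^ (dq n / 2 - 1) +
          ((H.card : ℝ) + 1) * (n : ℝ) ^ 2 * (1 / 9 : ℝ) ^ (dq n / 2 - dq n / 4)) := by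
    intro v hv hvt
    have h163 := tilted_designValue_avg_le_cutoff_pow_J hdes hN H rfl h9 h2h hs₀ hD4 hDT ha₁ hR1 hRa hRb hq hθ f hG hf0 v hv
      (fun M => htc M.2.partner (v M) (hvt M))
    simpa only [hf] using h163
  have hmain := h150 n hn₀ heven hbal col fU hG0 hf0' hfG hfinv hBtc β hβ Y hY
  simpa only [hf] using hmain

/-! ### §2 (CG_1′) for junta masks on blocks with `100|H|(|H|+1) ≤ n·dq n` in all directions, literal form -/

/-- **(CG_1′) FOR JUNTA MASKS ON BLOCKS WITH `100|H|(|H|+1) ≤ n·dq n`, pair-symmetric fields.** There are `a > 0` and `n₀` such that for all even `n ≥ n₀`,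
every balanced `B = 20` Chebyshev design `(t, C, w)`, every block `H` with `100|H|(|H|+1) ≤ n·dq n`, every junta mask `0 ≤ f ≤ G` of
the in-set and every pair-symmetric direction field `c_M : [n] → [−1,1]`:
`Σ_M Σ_U W(U,M)·f(U∩H)·(Σ_p c_M(p) x_p x_{π_M p})² ≤ 20G((4h+t+5Tq n+4)²(1/3)^{⌊dq n/2⌋−1} + (h+1)n²(1/9)^{⌊dq n/2⌋−⌊dq n/4⌋}) + 160Gn⁶e^{−a·dq n}`
(`h = |H|`; brick 148 §4 with the identity colouring of `H` + brick 163c's cut-off headline). [cite: Rothvoss2017, §2 and Lemma 7 (PDF pp. 5–8)]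
[cite: KeevashLifshitz2023, Thm. 1.8] -/
theorem mediumJunta_allDirections_pairSymm_le :
    ∃ a : ℝ, 0 < a ∧ ∃ n₀ : ℕ, ∀ n : ℕ, n₀ ≤ n → Even n → ∀ {t : ℕ} {C : Finset ℕ} {w : ℕ → ℝ},
    IsBalancedDesign n t (Tq n) (dq n) 20 C w →
    ∀ (H : Finset (Fin n)), 100 * (H.card * (H.card + 1)) ≤ n * dq n →
    ∀ (f : Finset (Fin n) → ℝ) {G : ℝ}, (∀ I, |f I| ≤ G) → (∀ I, 0 ≤ f I) →
    ∀ (c : PMatch n → Fin n → ℝ), (∀ M p, |c M p| ≤ 1) → (∀ M p, c M (M.2.partner p) = c M p) →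
    ∑ M : PMatch n, ∑ U : OddSet n, levelWeight n t C w U M *
        (f (U.1 ∩ H) *
          (∑ p : Fin n, c M p * ((if p ∈ U.1 then (1 : ℝ) else 0) * (if M.2.partner p ∈ U.1 then (1 : ℝ) else 0))) ^ 2) ≤
      20 * G * ((4 * (H.card : ℝ) + t + 5 * (Tq n) + 4) ^ 2 * (1 / 3 : ℝ) ^ (dq n / 2 - 1) +
          ((H.card : ℝ) + 1) * (n : ℝ) ^ 2 * (1 / 9 : ℝ) ^ (dq n / 2 - dq n / 4)) +
        160 * G * (n : ℝ) ^ 6 * Real.exp (-(a * dq n)) := by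
  classical
  obtain ⟨a, ha, n₁, hrung⟩ := rectangleDecayExp_all_holds
  refine ⟨a, ha, max n₁ (12100 * 12100), ?_⟩
  intro n hn heven t C w hbal H hh f G hG hf0 c hc hcπ
  have hn₁ : n₁ ≤ n := le_trans (le_max_left _ _) hn
  have hm : 12100 ≤ Nat.sqrt n := by rw [Nat.le_sqrt]; exact le_trans (le_max_right _ _) hn
  have h256 : 256 ≤ n := le_trans (by norm_num) (le_trans (le_max_right _ _) hn)
  obtain ⟨hD4, hDT⟩ := dq_facts h256
  have hdes : IsExactDesign n t (Tq n) (dq n) 20 C w := hbal.1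
  have hG0 : 0 ≤ G := (abs_nonneg _).trans (hG ∅)
  have hN : (univ : Finset (Fin n)).card = 2 * (n / 2) := by
    rw [card_univ, Fintype.card_fin]; obtain ⟨k, hk⟩ := heven; omega
  have hn4 : n ≤ 4 * t := hbal.2
  have h2t : 2 * t + 2 ≤ n := hbal.1.2.1
  obtain ⟨s₀, hs₀⟩ := hbal.1.1
  obtain ⟨h9, h2h, ha₁, hR1, hRa, hRb, hq, hθ⟩ := sqrtD_block_admissible (n := n) (h := H.card) hs₀ hn4 h2t hh hm
  have hR := hrung n hn₁ heven t C w hbal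
  obtain ⟨col, hc0, hcfix, htc⟩ := identityColour_facts H
  set fU : Finset (Fin n) → ℝ := fun U => f (U ∩ H) with hf
  have hf0' : ∀ U, 0 ≤ fU U := fun U => hf0 _
  have hfG : ∀ U, fU U ≤ G := fun U => (le_abs_self _).trans (hG _)
  have hfinv : ∀ (M : PMatch n) (g : Equiv.Perm (Fin n)), (∀ i, g (M.2.partner i) = M.2.partner (g i)) →
      (∀ i, col (g i) = col i) → ∀ U : Finset (Fin n), fU (U.map g.toEmbedding) = fU U := by
    intro M g _ hg U
    rw [hf]
    simp only
    rw [hcfix g hg U]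
  have h148 := colourSymmetric_allDirections_reduction hbal.1.1 C w hR col fU hG0 hf0' hfG hfinv c hc hcπ
  set v : PMatch n → Fin n → ℝ := fun M p =>
    (∑ q ∈ univ.filter (fun q => s(col q, col (M.2.partner q)) = s(col p, col (M.2.partner p))), c M q) /
      ((univ.filter fun q => s(col q, col (M.2.partner q)) = s(col p, col (M.2.partner p))).card : ℝ) with hvdef
  have hv1 : ∀ M p, |v M p| ≤ 1 := fun M p => abs_classAvg_le_one _ (c M) (hc M)
  have hvt : ∀ (M : PMatch n) p p', s(col p, col (M.2.partner p)) = s(col p', col (M.2.partner p')) → v M p = v M p' :=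
    fun M p p' hpp' => by simp only [hvdef, hpp']
  have h160 := tilted_designValue_avg_le_cutoff_pow_J hdes hN H rfl h9 h2h hs₀ hD4 hDT ha₁ hR1 hRa hRb hq hθ f hG hf0 v hv1
    (fun M => htc M.2.partner (v M) (hvt M))
  simp only [hf, hvdef] at h148 h160
  linarith [h148, h160]

/-- **(CG_1′) FOR JUNTA MASKS ON BLOCKS WITH `100|H|(|H|+1) ≤ n·dq n`, LITERAL FORM (brick 163e).** For some `a > 0` and all large even `n`: every balanced
`B = 20` Chebyshev design, every block `H` with `100|H|(|H|+1) ≤ n·dq n`, every junta mask `0 ≤ f ≤ G` of the in-set and EVERY direction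
field `v : PM_n → [n] → [−1,1]` satisfy
`Σ_M (Σ_U W(U,M)·f(U∩H)·(Σ_p v_M(p)·x_p x_{π_M p})²)₊ ≤ 20G((4h+t+5Tq n+4)²(1/3)^{⌊dq n/2⌋−1} + (h+1)n²(1/9)^{⌊dq n/2⌋−⌊dq n/4⌋}) + 160Gn⁶e^{−a·dq n}`.
[cite: Rothvoss2017, §2 and Lemma 7 (PDF pp. 5–8)] [cite: KeevashLifshitz2023, Thm. 1.8] -/
theorem mediumJunta_containment_allDirections_decay :
    ∃ a : ℝ, 0 < a ∧ ∃ n₀ : ℕ, ∀ n : ℕ, n₀ ≤ n → Even n → ∀ {t : ℕ} {C : Finset ℕ} {w : ℕ → ℝ},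
    IsBalancedDesign n t (Tq n) (dq n) 20 C w →
    ∀ (H : Finset (Fin n)), 100 * (H.card * (H.card + 1)) ≤ n * dq n →
    ∀ (f : Finset (Fin n) → ℝ) {G : ℝ}, (∀ I, |f I| ≤ G) → (∀ I, 0 ≤ f I) →
    ∀ (v : PMatch n → Fin n → ℝ), (∀ M p, |v M p| ≤ 1) →
    ∑ M : PMatch n, max (∑ U : OddSet n, levelWeight n t C w U M *
        (f (U.1 ∩ H) *
          (∑ p : Fin n, v M p * ((if p ∈ U.1 then (1 : ℝ) else 0) * (if M.2.partner p ∈ U.1 then (1 : ℝ) else 0))) ^ 2)) 0 ≤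
      20 * G * ((4 * (H.card : ℝ) + t + 5 * (Tq n) + 4) ^ 2 * (1 / 3 : ℝ) ^ (dq n / 2 - 1) +
          ((H.card : ℝ) + 1) * (n : ℝ) ^ 2 * (1 / 9 : ℝ) ^ (dq n / 2 - dq n / 4)) +
        160 * G * (n : ℝ) ^ 6 * Real.exp (-(a * dq n)) := by
  classical
  obtain ⟨a, ha, n₀, h161⟩ := mediumJunta_allDirections_pairSymm_le
  refine ⟨a, ha, n₀, ?_⟩
  intro n hn hev t C w hdes H hH f G hG hf0 v hv
  obtain ⟨c, hc⟩ : ∃ c : PMatch n → Fin n → ℝ, ∀ M p, c M p =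
      if 0 ≤ ∑ U : OddSet n, levelWeight n t C w U M * (f (U.1 ∩ H) *
          (∑ p : Fin n, v M p * ((if p ∈ U.1 then (1 : ℝ) else 0) * (if M.2.partner p ∈ U.1 then (1 : ℝ) else 0))) ^ 2)
      then (v M p + v M (M.2.partner p)) / 2 else 0 := ⟨_, fun _ _ => rfl⟩
  have hc1 : ∀ M p, |c M p| ≤ 1 := fun M p => by
    rw [hc]
    split_ifs
    · have h1 := abs_le.1 (hv M p); have h2 := abs_le.1 (hv M (M.2.partner p))
      rw [abs_le]; constructor <;> linarith
    · simp
  have hcπ : ∀ M p, c M (M.2.partner p) = c M p := fun M p => by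
    rw [hc, hc, M.2.partner_partner]
    split_ifs <;> ring
  have key := h161 n hn hev hdes H hH f hG hf0 c hc1 hcπ
  refine le_trans (le_of_eq (sum_congr rfl fun M _ => ?_)) key
  by_cases hpos : 0 ≤ ∑ U : OddSet n, levelWeight n t C w U M * (f (U.1 ∩ H) *
      (∑ p : Fin n, v M p * ((if p ∈ U.1 then (1 : ℝ) else 0) * (if M.2.partner p ∈ U.1 then (1 : ℝ) else 0))) ^ 2)
  · rw [max_eq_left hpos]
    refine Fintype.sum_congr _ _ fun U => ?_
    rw [containment_pairSymm M U.1 (v M)]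
    congr 3
    refine sum_congr rfl fun p _ => ?_
    rw [hc, if_pos hpos]
  · rw [max_eq_right (le_of_lt (lt_of_not_ge hpos))]
    symm
    refine sum_eq_zero fun U _ => ?_
    have : ∑ p : Fin n, c M p * ((if p ∈ U.1 then (1 : ℝ) else 0) * (if M.2.partner p ∈ U.1 then (1 : ℝ) else 0)) = 0 :=
      sum_eq_zero fun p _ => by rw [hc, if_neg hpos, zero_mul]
    rw [this]; ring

end Summit.PneNP.PneNP.Theorems.ChebyshevTracialDesignTiltedJuntaRungsCutoff

end
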